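import Literature.Analysis.FluidPDE.NavierStokesReynoldsStepsProofs
import Literature.Analysis.FluidPDE.CLConvexIntegration
import HarnessLib

/-!
# Cheskidov–Luo 2022, Prop. 2.2 (the main iteration), discharged

A. Cheskidov, X. Luo, *Sharp nonuniqueness for the Navier–Stokes equations*, Invent. Math. 229
(2022) 987–1054 = arXiv:2009.06596 (numbering of the held arXiv copy). Proof file for the named
fact `Torus.CheskidovLuo2022MainIteration` of `Literature.Analysis.FluidPDE.NavierStokesReynolds`
(Prop. 2.2): the discharge

* `Torus.CheskidovLuo2022MainIteration_holds : CheskidovLuo2022MainIteration`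

is the proved assembly `Torus.CheskidovLuo2022MainIteration_of_steps` (file
`NavierStokesReynoldsSteps`; §4, after Prop. 4.1: "It is clear that Proposition 2.2 follows from
Proposition 3.1 and Proposition 4.1") applied to the two discharged steps,
`Torus.CheskidovLuo2022Concentration_holds` (Prop. 3.1, file `NavierStokesReynoldsStepsProofs`) and
`Torus.CheskidovLuo2022ConvexIntegration_holds` (Prop. 4.1, file `CLConvexIntegration`), through
`Torus.CheskidovLuo2022MainIteration_of_convexIntegration`.

The discharge cannot be appended to `NavierStokesReynolds` itself (the proof files import it).

## References

* A. Cheskidov, X. Luo, *Sharp nonuniqueness for the Navier–Stokes equations*, Invent. Math. 229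
  (2022), 987–1054; arXiv:2009.06596: Prop. 2.2, Prop. 3.1, Prop. 4.1 and the sentence following
  it. [`CheskidovLuo2022`]
-/

noncomputable section

namespace Literature.Analysis.FluidPDE

namespace Torus

variable {d : Type*} [Fintype d] [DecidableEq d]

/-- **Cheskidov–Luo 2022, Prop. 2.2 (Main iteration), PROVED** for the rendering
`Torus.CheskidovLuo2022MainIteration` (see its docstring for the printed statement and the two
documented corrections): Prop. 3.1 (`CheskidovLuo2022Concentration_holds`) and Prop. 4.1
(`CheskidovLuo2022ConvexIntegration_holds`) assembled by `CheskidovLuo2022MainIteration_of_steps`.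
[cite: CheskidovLuo2022, Prop. 2.2] -/
theorem CheskidovLuo2022MainIteration_holds : CheskidovLuo2022MainIteration (d := d) :=
  CheskidovLuo2022MainIteration_of_convexIntegration CheskidovLuo2022ConvexIntegration_holds

end Torus

end Literature.Analysis.FluidPDE

end
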